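import Summits.HodgeConjecture.CorCM.IrreducibleOddWeightsCMTypes
import HarnessLib

/-!
# Irreducible odd weights: every failure of (SC) is a commutant direction — `p` non-self-conjugate stabiliser orbit
# pairs force capacity at most `n/(p+1)`

COR-CM (cell `pub-hodgecm2`, binder seat `b16` gen 55, count-neutral claim IRR-ODD, file F3 — abstract `G`-set level,
sequel of F1 `CorCM/IrreducibleOddWeights` / F1b `CorCM/IrreducibleOddWeightsCMTypes`; theorems only, no definition, no
named fact, no `sorry`).  NEW as stated, hence under `Summits/`.  HONEST FRAMING: finite-dimensional linear algebra about
the Kubota–Dodson rank of same-slot families of CM types; `HC_CM` is neither used nor asserted.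

F1b proved: if the `ρ`-odd weights `Anti ≤ ℚ^X` are irreducible and `d` odd-valued equivariant endomorphisms of `ℚ^X`
are linearly independent on `Anti`, every nondegenerate same-slot family has `|I|·d ≤ n` (`|X| = 2n`), and ONE failure
of multiplicity one gives `d ≥ 2`.  Here the commutant directions are produced from the ORBIT STRUCTURE of a point
stabiliser, as in seat gen 54's proof of (M1) ⟹ (SC) (`StabConj.stabConj_of_multiplicityOne`): for `x₀, y₀ ∈ X` the
ORBITAL KERNEL `R(y, z) = [∃ g, g x₀ = y ∧ g y₀ = z]` is `G`-invariant, and `(T f)(z) = Σ_y f(y)(R(y,z) − R(y,ρz))` is a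
`G`-equivariant odd-valued endomorphism of `ℚ^X` with `T δ_{x₀} = 𝟙_{Stab(x₀)y₀} − 𝟙_{ρ Stab(x₀)y₀}`
(`exists_orbitalOperator`).  If (SC) FAILS at `(x₀, y₀)` — no `g ∈ Stab(x₀)` has `g y₀ = ρ y₀`, i.e. the orbit
`Stab(x₀)y₀` is NOT self-conjugate — this vector is not a multiple of `δ_{x₀} − δ_{ρx₀}`; and `p` such points
`y_1, …, y_p ∉ {x₀, ρx₀}` lying in `p` DIFFERENT non-self-conjugate orbit pairs `{O_j, ρO_j}` give, together with
`P : f ↦ f − f∘ρ`, `p + 1` odd-valued equivariant endomorphisms LINEARLY INDEPENDENT on `Anti`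
(`linearIndependent_orbitalOperators`: evaluate `Σ_j c_j T_j (δ_{x₀} − δ_{ρx₀}) = 2 Σ_j c_j T_j δ_{x₀}` at `x₀` and at the
`y_k`).  Hence:

> **`succ_mul_card_le_of_irreducible_of_orbits`** — (IRR) and `p` pairwise non-associate failures of (SC) at one base
> point `x₀` ⟹ every nondegenerate same-slot family of CM types has `(p + 1)·|I| ≤ |X|/2`.

By Wielandt's count (`dim End_G(Anti) = 1 +` the number of non-self-conjugate orbit pairs of `Stab(x₀)` off
`{x₀, ρx₀}`, for `G` transitive; not needed and not proved here) the bound is the capacity `n/d` of F1 exactly when the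
`y_j` represent ALL non-self-conjugate orbit pairs.  Numerics (gen 54 census, not kernel): the octic Galois types with
(IRR) but not (SC) have `p = 1` (closure orders 16, 16, 16, 16, 24, 32: capacity `2`) or `p = 3` (the Galois `C₈`, `Q₈`
octics: capacity `1`).  Sequel F3b `CorCM/IrreducibleOddWeightsOrbitCapacity`: the CM-field dress.

## References

* [Wielandt1964] H. Wielandt, *Finite Permutation Groups* (1964), Thm. 28.4 (the centraliser algebra and the orbitals).
* [Serre1977] J.-P. Serre, *Linear Representations of Finite Groups*, GTM 42 (1977), §2.2 Prop. 4, §12.2.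
* [Mai1989] L. Mai, *Lower bounds for the ranks of CM types*, J. Number Theory 32 (1989), §2 Prop. 1 (proof).
* [Gordon1999HodgeAVSurvey] B. B. Gordon, *A survey of the Hodge conjecture for abelian varieties*, 7.5–7.7.
-/

set_option autoImplicit false

noncomputable section

open scoped BigOperators

universe u v w

namespace Summit.HodgeConjecture.CorCM.IrrOdd

open Literature.NumberTheory.ComplexMultiplication

variable {G : Type w} [Group G] {I : Type u} {X : Type v} [MulAction G X]

open scoped Classical

/-! ### §1 The orbital operator of a pair `(x₀, y₀)` -/

section Orbital

variable {ρ : G}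

/-- **An odd-valued equivariant endomorphism turns `f ∘ ρ` into `−T f`** (`ρ` central: `T(f∘ρ) = (Tf)∘ρ`).
[cite: Serre1977, §2.2 Prop. 4] -/
theorem apply_comp_rho_eq_neg (T : (X → ℚ) →ₗ[ℚ] (X → ℚ))
    (hT : ∀ (g : G) (f : X → ℚ), T (fun x => f (g⁻¹ • x)) = fun x => T f (g⁻¹ • x))
    (hTodd : ∀ (f : X → ℚ) (x : X), T f (ρ • x) = -T f x) (f : X → ℚ) :
    T (fun x => f (ρ • x)) = -T f := by
  have h1 := hT ρ⁻¹ f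
  rw [inv_inv] at h1
  rw [h1]
  funext x
  simp only [Pi.neg_apply, hTodd]

/-- **`T(δ_{x₀} − δ_{ρx₀}) = 2·T δ_{x₀}`** for an odd-valued equivariant `T` (`δ_{ρx₀} = δ_{x₀} ∘ ρ`, `ρ` an involution).
[cite: Serre1977, §2.2 Prop. 4] -/
theorem apply_single_sub_single_rho (hi : ∀ x : X, ρ • ρ • x = x) (T : (X → ℚ) →ₗ[ℚ] (X → ℚ))
    (hT : ∀ (g : G) (f : X → ℚ), T (fun x => f (g⁻¹ • x)) = fun x => T f (g⁻¹ • x))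
    (hTodd : ∀ (f : X → ℚ) (x : X), T f (ρ • x) = -T f x) (x₀ : X) :
    T ((fun y => if y = x₀ then (1 : ℚ) else 0) - fun y => if y = ρ • x₀ then (1 : ℚ) else 0) =
      (2 : ℚ) • T (fun y => if y = x₀ then (1 : ℚ) else 0) := by
  have hρδ : (fun y => if y = ρ • x₀ then (1 : ℚ) else 0) = fun y => if ρ • y = x₀ then (1 : ℚ) else 0 := by
    funext y
    have hiff : y = ρ • x₀ ↔ ρ • y = x₀ :=
      ⟨fun h => by rw [h, hi], fun h => by rw [← h, hi]⟩
    simp only [hiff]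
  have h2 : T (fun y => if ρ • y = x₀ then (1 : ℚ) else 0) = -T (fun y => if y = x₀ then (1 : ℚ) else 0) :=
    apply_comp_rho_eq_neg T hT hTodd (fun y' => if y' = x₀ then (1 : ℚ) else 0)
  rw [map_sub, hρδ, h2, sub_neg_eq_add, two_smul]

variable [Fintype X]

/-- **THE ORBITAL OPERATOR of `(x₀, y₀)`.**  With the `G`-invariant orbital kernel `R(y,z) = [∃ g, g x₀ = y ∧ g y₀ = z]`,
`(T f)(z) = Σ_y f(y)(R(y,z) − R(y,ρz))` is a `G`-equivariant endomorphism of `ℚ^X` with `ρ`-odd values and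
`(T δ_{x₀})(z) = [z ∈ Stab(x₀)y₀] − [ρz ∈ Stab(x₀)y₀]` (`ρ` central and involutive; no transitivity needed).
[cite: Wielandt1964, Thm. 28.4] -/
theorem exists_orbitalOperator (hc : ∀ (g : G) (x : X), g • ρ • x = ρ • g • x) (hi : ∀ x : X, ρ • ρ • x = x)
    (x₀ y₀ : X) :
    ∃ T : (X → ℚ) →ₗ[ℚ] (X → ℚ),
      (∀ (g : G) (f : X → ℚ), T (fun x => f (g⁻¹ • x)) = fun x => T f (g⁻¹ • x)) ∧
      (∀ (f : X → ℚ) (x : X), T f (ρ • x) = -T f x) ∧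
      ∀ z : X, T (fun y => if y = x₀ then (1 : ℚ) else 0) z =
        (if ∃ g : G, g • x₀ = x₀ ∧ g • y₀ = z then (1 : ℚ) else 0) -
          if ∃ g : G, g • x₀ = x₀ ∧ g • y₀ = ρ • z then (1 : ℚ) else 0 := by
  classical
  -- the orbital kernel of `(x₀, y₀)`
  let R : X → X → ℚ := fun y z => if ∃ g : G, g • x₀ = y ∧ g • y₀ = z then 1 else 0
  have hR : ∀ (k : G) (y z : X), R (k • y) z = R y (k⁻¹ • z) := by
    intro k y z
    have hiff : (∃ g : G, g • x₀ = k • y ∧ g • y₀ = z) ↔ ∃ g : G, g • x₀ = y ∧ g • y₀ = k⁻¹ • z := by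
      constructor
      · rintro ⟨g, hg₀, hgx⟩
        exact ⟨k⁻¹ * g, by rw [mul_smul, hg₀, inv_smul_smul], by rw [mul_smul, hgx]⟩
      · rintro ⟨g, hg₀, hgx⟩
        exact ⟨k * g, by rw [mul_smul, hg₀], by rw [mul_smul, hgx, smul_inv_smul]⟩
    by_cases hP : ∃ g : G, g • x₀ = k • y ∧ g • y₀ = z
    · simp only [R, if_pos hP, if_pos (hiff.1 hP)]
    · simp only [R, if_neg hP, if_neg (mt hiff.2 hP)]
  let T : (X → ℚ) →ₗ[ℚ] (X → ℚ) :=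
    { toFun := fun f z => ∑ y, f y * (R y z - R y (ρ • z))
      map_add' := fun f f' => by
        funext z
        simp only [Pi.add_apply, add_mul, Finset.sum_add_distrib]
      map_smul' := fun c f => by
        funext z
        simp only [Pi.smul_apply, smul_eq_mul, RingHom.id_apply, Finset.mul_sum, mul_assoc] }
  have hTapp : ∀ (f : X → ℚ) (z : X), T f z = ∑ y, f y * (R y z - R y (ρ • z)) := fun f z => rfl
  refine ⟨T, fun k f => ?_, fun f z => ?_, fun z => ?_⟩
  · funext z
    rw [hTapp, hTapp]
    rw [← Equiv.sum_comp (MulAction.toPerm k) (fun y => f (k⁻¹ • y) * (R y z - R y (ρ • z)))]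
    refine Finset.sum_congr rfl fun y _ => ?_
    simp only [MulAction.toPerm_apply, inv_smul_smul]
    rw [hR k y z, hR k y (ρ • z), hc]
  · rw [hTapp, hTapp, ← Finset.sum_neg_distrib]
    refine Finset.sum_congr rfl fun y _ => ?_
    rw [hi]
    ring
  · rw [hTapp]
    simp only [ite_mul, one_mul, zero_mul, Finset.sum_ite_eq', Finset.mem_univ, if_true, R]

end Orbital

/-! ### §2 `p` non-self-conjugate orbit pairs: `p + 1` independent commutant directions; capacity `n/(p+1)` -/

section Capacity

variable [Fintype X] {ρ : G}

/-- **`p` failures of (SC) at `x₀` in `p` different orbit pairs give `p + 1` odd-valued equivariant endomorphisms of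
`ℚ^X`, linearly independent on `Anti`**: `T₀ = (f ↦ f − f∘ρ)` and the orbital operators `T_j` of `(x₀, y_j)`.  (On
`δ_{x₀} − δ_{ρx₀} ∈ Anti`: `T₀` gives `2(δ_{x₀} − δ_{ρx₀})`, `T_j` gives `2(𝟙_{O_j} − 𝟙_{ρO_j})`, `O_j = Stab(x₀)y_j` —
evaluate at `x₀` and at `y_k`.) [cite: Wielandt1964, Thm. 28.4] [cite: Serre1977, §2.2 Prop. 4 and §12.2] -/
theorem exists_orbitalOperators_linearIndependent (hc : ∀ (g : G) (x : X), g • ρ • x = ρ • g • x)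
    (hi : ∀ x : X, ρ • ρ • x = x) (hρ : ∀ x : X, ρ • x ≠ x) {p : ℕ} {x₀ : X} (y : Fin p → X)
    (hy₀ : ∀ j, y j ≠ x₀) (hy₀' : ∀ j, y j ≠ ρ • x₀)
    (hncs : ∀ j (g : G), g • x₀ = x₀ → g • y j ≠ ρ • y j)
    (hsep : ∀ j k, j ≠ k → ∀ g : G, g • x₀ = x₀ → g • y j ≠ y k ∧ g • y j ≠ ρ • y k) :
    ∃ T : Fin (p + 1) → ((X → ℚ) →ₗ[ℚ] (X → ℚ)),
      (∀ j (g : G) (f : X → ℚ), T j (fun x => f (g⁻¹ • x)) = fun x => T j f (g⁻¹ • x)) ∧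
      (∀ j (f : X → ℚ) (x : X), T j f (ρ • x) = -T j f x) ∧
      ∀ c : Fin (p + 1) → ℚ, (∀ a ∈ antiWeights (E := X) ρ, ∑ j, c j • T j a = 0) → ∀ j, c j = 0 := by
  classical
  -- the projection and the orbital operators
  let P : (X → ℚ) →ₗ[ℚ] (X → ℚ) := LinearMap.id - LinearMap.funLeft ℚ ℚ fun x : X => ρ • x
  have hP : ∀ f, P f = fun x => f x - f (ρ • x) := fun f => rfl
  have hPeq : ∀ (g : G) (f : X → ℚ), P (fun x => f (g⁻¹ • x)) = fun x => P f (g⁻¹ • x) := fun g f => by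
    rw [hP, hP]
    funext x
    simp only [hc]
  have hPodd : ∀ (f : X → ℚ) (x : X), P f (ρ • x) = -P f x := fun f x => by
    simp only [hP, hi]
    ring
  choose S hSeq hSodd hSδ using fun j => exists_orbitalOperator hc hi x₀ (y j)
  let T : Fin (p + 1) → ((X → ℚ) →ₗ[ℚ] (X → ℚ)) := Fin.cons P S
  have hT0 : T 0 = P := rfl
  have hTs : ∀ j : Fin p, T j.succ = S j := fun j => by simp only [T, Fin.cons_succ]
  refine ⟨T, fun j => Fin.cases hPeq (fun j => by rw [hTs]; exact hSeq j) j,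
    fun j => Fin.cases hPodd (fun j => by rw [hTs]; exact hSodd j) j, fun c hc0 => ?_⟩
  -- the point masses at `x₀` and `ρ x₀`
  let δ₀ : X → ℚ := fun z => if z = x₀ then 1 else 0
  let δ₁ : X → ℚ := fun z => if z = ρ • x₀ then 1 else 0
  have hmemA : ∀ f : X → ℚ, f ∈ antiWeights (E := X) ρ ↔ ∀ x, f (ρ • x) = -f x := fun f => Iff.rfl
  have hu : (δ₀ - δ₁ : X → ℚ) ∈ antiWeights (E := X) ρ := by
    rw [hmemA]
    intro x
    have h1 : (ρ • x = x₀) ↔ x = ρ • x₀ := ⟨fun h => by rw [← h, hi], fun h => by rw [h, hi]⟩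
    have h2 : (ρ • x = ρ • x₀) ↔ x = x₀ := ⟨fun h => by simpa only [hi] using congrArg (ρ • ·) h,
      fun h => by rw [h]⟩
    simp only [Pi.sub_apply, δ₀, δ₁, h1, h2]
    ring
  -- `Σ_j c_j T_j δ₀ = 0`
  have hTδ : ∀ j, T j (δ₀ - δ₁) = (2 : ℚ) • T j δ₀ := fun j =>
    Fin.cases (apply_single_sub_single_rho hi P hPeq hPodd x₀)
      (fun j => by rw [hTs]; exact apply_single_sub_single_rho hi (S j) (hSeq j) (hSodd j) x₀) j
  have hsum : ∑ j, c j • T j δ₀ = 0 := by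
    have h1 := hc0 _ hu
    simp only [hTδ, smul_smul] at h1
    have h2 : (2 : ℚ) • ∑ j, c j • T j δ₀ = 0 := by
      rw [Finset.smul_sum]
      simpa only [smul_smul, mul_comm (2 : ℚ)] using h1
    exact (smul_eq_zero.1 h2).resolve_left two_ne_zero
  -- the values of `T_j δ₀` at `x₀` and at `y_k`
  have hP0 : P δ₀ x₀ = 1 := by
    have hx : ¬ ρ • x₀ = x₀ := hρ x₀
    simp only [hP, δ₀, if_true, if_neg hx, sub_zero]
  have hPk : ∀ k, P δ₀ (y k) = 0 := fun k => by
    have h1 : ¬ ρ • y k = x₀ := fun h => hy₀' k (by rw [← h, hi])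
    simp only [hP, δ₀, if_neg (hy₀ k), if_neg h1, sub_zero]
  have hS0 : ∀ j, S j δ₀ x₀ = 0 := fun j => by
    rw [hSδ]
    have h1 : ¬ ∃ g : G, g • x₀ = x₀ ∧ g • y j = x₀ := by
      rintro ⟨g, hg₀, hgy⟩
      exact hy₀ j (smul_left_cancel g (hgy.trans hg₀.symm))
    have h2 : ¬ ∃ g : G, g • x₀ = x₀ ∧ g • y j = ρ • x₀ := by
      rintro ⟨g, hg₀, hgy⟩
      refine hy₀' j (smul_left_cancel g ?_)
      rw [hgy, hc, hg₀]
    rw [if_neg h1, if_neg h2, sub_zero]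
  have hSk : ∀ j k, S j δ₀ (y k) = if j = k then 1 else 0 := fun j k => by
    rw [hSδ]
    by_cases hjk : j = k
    · subst hjk
      rw [if_pos ⟨1, one_smul G x₀, one_smul G (y j)⟩, if_neg, if_pos rfl, sub_zero]
      rintro ⟨g, hg₀, hgy⟩
      exact hncs j g hg₀ hgy
    · rw [if_neg, if_neg, if_neg hjk, sub_zero]
      · rintro ⟨g, hg₀, hgy⟩
        exact (hsep j k hjk g hg₀).2 hgy
      · rintro ⟨g, hg₀, hgy⟩
        exact (hsep j k hjk g hg₀).1 hgy
  -- conclusion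
  have hck : ∀ k : Fin p, c k.succ = 0 := fun k => by
    have h1 := congrFun hsum (y k)
    rw [Finset.sum_apply, Fin.sum_univ_succ, Pi.zero_apply] at h1
    simp only [Pi.smul_apply, smul_eq_mul, hT0, hPk, mul_zero, zero_add, hTs, hSk, mul_ite, mul_one,
      Finset.sum_ite_eq', Finset.mem_univ, if_true] at h1
    exact h1
  have hc00 : c 0 = 0 := by
    have h1 := congrFun hsum x₀
    rw [Finset.sum_apply, Fin.sum_univ_succ, Pi.zero_apply] at h1
    simp only [Pi.smul_apply, smul_eq_mul, hT0, hP0, mul_one, hTs, hS0, mul_zero, Finset.sum_const_zero,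
      add_zero] at h1
    exact h1
  intro j
  exact Fin.cases hc00 hck j

variable [DecidableEq I] [Fintype I] [Nonempty X] [Nonempty I]

/-- **CAPACITY FROM THE ORBIT STRUCTURE.**  (IRR) for the `ρ`-odd weights, and `p` points `y_1, …, y_p ∉ {x₀, ρx₀}` at
which (SC) FAILS for the base point `x₀` (no `g ∈ Stab(x₀)` with `g y_j = ρ y_j`) lying in `p` different orbit pairs
(`Stab(x₀) y_j ∌ y_k, ρ y_k` for `j ≠ k`) ⟹ EVERY NONDEGENERATE SAME-SLOT FAMILY OF CM TYPES HAS
`(p + 1)·|I| ≤ |X|/2`.  (`p = 0`: Kubota's bound `n`; `p = 1`: F1b's `n/2`; `p =` all non-self-conjugate orbit pairs: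
the capacity `n/dim End_G(Anti)`.) [cite: Wielandt1964, Thm. 28.4] [cite: Mai1989, §2 Prop. 1 (proof)]
[cite: Gordon1999HodgeAVSurvey, 7.7] -/
theorem succ_mul_card_le_of_irreducible_of_orbits (Φ : I → Set X) (h : ∀ i, IsCMTypeWith ρ (Φ i))
    (hirr : ∀ W : Submodule ℚ (X → ℚ), W ≤ antiWeights (E := X) ρ → W ≠ ⊥ →
      (∀ (k : G) (f : X → ℚ), f ∈ W → (fun y => f (k • y)) ∈ W) → W = antiWeights (E := X) ρ)
    (hnd : typeRank G (sigmaType (E := fun _ : I => X) Φ) = Fintype.card (Σ _ : I, X) / 2 + 1)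
    {p : ℕ} {x₀ : X} (y : Fin p → X) (hy₀ : ∀ j, y j ≠ x₀) (hy₀' : ∀ j, y j ≠ ρ • x₀)
    (hncs : ∀ j (g : G), g • x₀ = x₀ → g • y j ≠ ρ • y j)
    (hsep : ∀ j k, j ≠ k → ∀ g : G, g • x₀ = x₀ → g • y j ≠ y k ∧ g • y j ≠ ρ • y k) :
    (p + 1) * Fintype.card I ≤ Fintype.card X / 2 := by
  have hρ := h (Classical.arbitrary I)
  obtain ⟨T, hT, hTodd, hTli⟩ :=
    exists_orbitalOperators_linearIndependent hρ.comm hρ.invol hρ.rho_smul_ne y hy₀ hy₀' hncs hsep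
  have key := card_mul_le_of_irreducible Φ h hirr hnd T hT hTodd hTli
  rwa [mul_comm] at key

/-- **One failure of (SC) suffices for capacity `n/2`** (the `p = 1` case, now with an explicit witness `(x₀, y₀)`
instead of F1b's negated multiplicity one). [cite: Wielandt1964, Thm. 28.4] [cite: Gordon1999HodgeAVSurvey, 7.7] -/
theorem two_mul_card_le_of_irreducible_of_not_stabConj_at (Φ : I → Set X) (h : ∀ i, IsCMTypeWith ρ (Φ i))
    (hirr : ∀ W : Submodule ℚ (X → ℚ), W ≤ antiWeights (E := X) ρ → W ≠ ⊥ →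
      (∀ (k : G) (f : X → ℚ), f ∈ W → (fun y => f (k • y)) ∈ W) → W = antiWeights (E := X) ρ)
    (hnd : typeRank G (sigmaType (E := fun _ : I => X) Φ) = Fintype.card (Σ _ : I, X) / 2 + 1)
    {x₀ y₀ : X} (hy₀ : y₀ ≠ x₀) (hy₀' : y₀ ≠ ρ • x₀) (hncs : ∀ g : G, g • x₀ = x₀ → g • y₀ ≠ ρ • y₀) :
    2 * Fintype.card I ≤ Fintype.card X / 2 :=
  succ_mul_card_le_of_irreducible_of_orbits Φ h hirr hnd (fun _ : Fin 1 => y₀) (fun _ => hy₀) (fun _ => hy₀')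
    (fun _ => hncs) (fun j k hjk => absurd (Subsingleton.elim j k) hjk)

end Capacity

end Summit.HodgeConjecture.CorCM.IrrOdd

end
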